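import Summits.ResolutionOfSingularities.ResolutionOfSingularities.Theorems.FaceCutKernels2
import HarnessLib

/-!
# FaceCutKernels3 — decomp-res node «FaceCut» (lens-2 g26, critic row 208 CLEARED), tree file 3/6 of the node

Content VERBATIM from the decomp-res lens-2 g26 node `HOME/decomp-res-lens-2/g26/FaceCut.lean` (pin dd1d04c7; no
carry, imports the landed g24 node only; ns `…Theses.FaceCut` ↦ `…Theorems.FaceCut`, sub-namespace `FaceX` kept);
HOME = run/shared/lean/pub/decomp-res; critic CRITIC-LEDGER row 208 CLEARED; landing orders INBOX :1364 / rider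
10:41:11Z — provenance, critic text and the lens header in the first file of the node, `FaceCutKernels`.  `--kind
proof --supports stmt-ResolutionOfSingularities-29273`.

## This file

Continuation 3/4 of `FaceCutKernels` (same namespace / sections of the node, cut at the tree's 400-line cap; section
variables / opens replayed): scopes `FaceRing` — carries `faceCheckExtra_u1u2five`, `faceFirstFail_u1u2five`,
`faceFirstFail_vu2six`, `faceCheckExtra_us4t`, `face_e0`, `face_e1`, `face_e2`, `face_e3`, `face_e4`, `face_e5`,
`face_e6`, `face_e7`, `face_e8`, `face_e9`, `face_e10`, `face_e11`, `face_e12`, `face_e13`, `face_e14`, `face_e15`,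
`face_e16`, `face_e17`, `face_e18`, `face_e19`, `face_e20`, `face_e21`, `face_e22`, `face_e23`, `face_e24`,
`face_e25`, `face_e26`, `face_e27`, `face_e28`, `face_e29`, `face_e30`, `face_e31`, `face_e32`, `face_e33`,
`face_e34`, `face_e35`, `face_e36`, `face_e37`, `face_e38`, `transport_ust_u`, `transport_ust_s`, `transport_ust_t`,
`transport_us_u`, `transport_us_s`, `transport_ut_u`, `transport_ut_t`, `transport_st_s`, `transport_st_t`,
`transport_strict`, `transport_Zchart`, `face_leaf1_u`, `face_leaf5_u_zero`, `face_leaf5_u_nonzero`, `face_leaf5_s`,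
`face_leaf6_u`, `face_leaf6_s_zero`, `face_leaf6_s_nonzero`, `face_leaf8_u_zero`, `face_leaf8_u_nonzero`, `face_leaf8_s`.

[WRITER NOTE (decomp-res writer g13): file split only (tree files ≤ 400 lines); sections, section variables / opens
and every declaration exactly as in the lens (the node's two HOME-only lines `linter.style.longFile` /
dupNamespace-linter are dropped; the namespace-level `open` lines of the node are replayed in every part, the `open
…Theses` line only in the Theses-cone file `MaxContactCutFaceCut`); namespace renamed `…Theses.FaceCut` ↦
`…Theorems.FaceCut`; the cone-free parts import `…Theorems.CuspCutCells2` (the landed g24 cells) instead of the g24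
wiring file, which only the cone file imports.]

(Sources: Hironaka1964 Ch. III §§1–3; CossartJannsenSaito2020 Ch. 2, Ch. 8–9; Matsumura1987 Thm 28.3, §29;
Cohen1946; ZariskiSamuelII Ch. VII §1; Bourbaki AC VII §3; CossartPiltant2008 Prop. 4.2, Lemma 4.3; Moh1987;
Hauser2010Kangaroo; BierstoneGrigorievMilmanWlodarczyk2011 §3; Cutkosky2009.)
-/

open CategoryTheory AlgebraicGeometry TopologicalSpace IsLocalRing
open Literature.AlgebraicGeometry.Resolution
open Summit.ResolutionOfSingularities.ResolutionOfSingularities.Theorems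
open Summit.ResolutionOfSingularities.ResolutionOfSingularities.Theorems.WeakOrderReduction
open Summit.ResolutionOfSingularities.ResolutionOfSingularities.Theorems.DeltaFaceCutClasses
open Summit.ResolutionOfSingularities.ResolutionOfSingularities.Theorems.RelativeDeltaCut
open Summit.ResolutionOfSingularities.ResolutionOfSingularities.Theorems.CurveLeafExit
open Summit.ResolutionOfSingularities.ResolutionOfSingularities.Theorems.PinchCut
open Summit.ResolutionOfSingularities.ResolutionOfSingularities.Theorems.JetCut
open Summit.ResolutionOfSingularities.ResolutionOfSingularities.Theorems.PurityCut
open Summit.ResolutionOfSingularities.ResolutionOfSingularities.Theorems.SplitCut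
open Summit.ResolutionOfSingularities.ResolutionOfSingularities.Theorems.CylinderCut
open Summit.ResolutionOfSingularities.ResolutionOfSingularities.Theorems.SpreadCut
open Summit.ResolutionOfSingularities.ResolutionOfSingularities.Theorems.CrossCut
open Summit.ResolutionOfSingularities.ResolutionOfSingularities.Theorems.DeepCrossCut
open Summit.ResolutionOfSingularities.ResolutionOfSingularities.Theorems.OddCrossCut
open Summit.ResolutionOfSingularities.ResolutionOfSingularities.Theorems.CuspCut

namespace Summit.ResolutionOfSingularities.ResolutionOfSingularities.Theorems.FaceCut

section FaceRing

variable {R : Type} [CommRing R]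

/-- **THE WEIGHT INEQUALITY IS LOAD-BEARING — an OFF-FACE cusp member breaks g24's package**: the cusp-class tail monomial
`u₁u₂⁵` (g24-legal: `2·6 ≥ 11`; weight `42 + 150 = 192 ≤ 210`: BELOW the face; after the tower `u²s`, weight `36 < 45`)
transported along the tree reaches node `ν4` (d3, chart `u`, centre `V(Z,u,s)`) as the monomial `s ∉ (u,s)²`: the round's
centre is NOT inside the order-2 locus of `Z² + us⁵ + ut³ + u³ + u²s`-type members — the package is not weakly admissible for
them.  (So `z̃² + u₁⁵ + v³u₂⁵ + u₂⁷ + u₁u₂⁵` over `𝔽₂`, a Top-isolated member of g24's cusp class, is NOT decided by the face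
package: it belongs to the residual `NonFaceCuspExit`.)  [kernel · `decide`] [folklore] -/
theorem faceCheckExtra_u1u2five : faceCheckExtra [(2, 1, 0)] = false := by decide

/-- … the audit's (sufficient) leaf test already breaks at the leaf `ν1` (d1, chart `u`, carrier `{u=0}`: the tail `us` has
`u`-order 1) — harmless for the member (there `F/u ≡ 1 + λs` on `E₁`, and along `E₁ ∩ {1 + λs = 0}` the initial form
`Z² + b₀uZ + λus' + γu²` has `τ = 3`: those points exit) — and PERMISSIBILITY breaks first at the internal node `ν4` = round R4,
centre `E₁ ∩ E₃` (g24 NODE §3.3), where the transported tail is `λ·s ∉ (u,s)²`: the centre is NOT inside the order-2 locus, the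
package is not weakly admissible for the member — a GENUINE failure. [kernel · `decide`] [folklore] -/
theorem faceFirstFail_u1u2five : faceFirstFail [(2, 1, 0)] = some 1 ∧ faceFirstCentreFail [(2, 1, 0)] = some 4 := by decide

/-- The other below-face cusp tails of `u`-degree 2 after the tower, e.g. `v·u₁^i u₂^{6−i}`-type `↦ u²t` (weight `40`):
the same two nodes. [kernel · `decide`] [folklore] -/
theorem faceFirstFail_vu2six : faceFirstFail [(2, 0, 1)] = some 1 ∧ faceFirstCentreFail [(2, 0, 1)] = some 4 := by decide

/-- A tail ON the weight-45 level other than the face itself does not occur in the class (NODE-g26 §2: the only monomials of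
weight `210` in a cusp-class member are `z̃², u₁⁵, v³u₂⁵, u₂⁷`); the first level above, e.g. `u s⁴ t` (weight `49`, a
generator of `J₀`), passes: [kernel · `decide`] [folklore] -/
theorem faceCheckExtra_us4t : faceCheckExtra [(1, 4, 1)] = true := by decide

/-! ### §F.0b  THE 39 CHART IDENTITIES WITH UNIT-SQUARE COEFFICIENTS (the face part of every controlled transform)

Edge `ν_p → ν_c` (centre `V(Z, x_A)` of `ν_p`, chart `x_j`): substituting `Z ↦ x_j Z`, `x_i ↦ x_j x_i (i ∈ A, i ≠ j)` into
`Z² + F0_p` gives `x_j² · (Z² + F0_c)` — for ARBITRARY coefficients `a b c` (the unit squares `d₀², d₁², d₂²` of the normal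
form; g24's `pilot_e*` are the case `a = b = c = 1`).  With the table's (T) this is the complete controlled transform of
`Z² + BZ + F0 + T` along the edge (tails and `B` by the monomial transport). [kernel · `ring`] -/

/-- edge ν0 → ν1: centre `V(Z,u,s,t)`, chart `u`. [kernel] [folklore] -/
theorem face_e0 (Z u s t a b c : R) :
    (u * Z) ^ 2 + (a * u^3 + b * u * (u * s)^5 + c * u * (u * t)^3) = u ^ 2 * (Z ^ 2 + (a * u + b * u^4 * s^5 + c * u^2 * t^3)) := by ring

/-- edge ν0 → ν2: centre `V(Z,u,s,t)`, chart `s`. [kernel] [folklore] -/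
theorem face_e1 (Z u s t a b c : R) :
    (s * Z) ^ 2 + (a * (s * u)^3 + b * (s * u) * s^5 + c * (s * u) * (s * t)^3) = s ^ 2 * (Z ^ 2 + (a * u^3 * s + b * u * s^4 + c * u * s^2 * t^3)) := by ring

/-- edge ν2 → ν3: centre `V(Z,u,s)`, chart `u`. [kernel] [folklore] -/
theorem face_e2 (Z u s t a b c : R) :
    (u * Z) ^ 2 + (a * u^3 * (u * s) + b * u * (u * s)^4 + c * u * (u * s)^2 * t^3) = u ^ 2 * (Z ^ 2 + (a * u^2 * s + b * u^3 * s^4 + c * u * s^2 * t^3)) := by ring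

/-- edge ν3 → ν4: centre `V(Z,u,s)`, chart `u`. [kernel] [folklore] -/
theorem face_e3 (Z u s t a b c : R) :
    (u * Z) ^ 2 + (a * u^2 * (u * s) + b * u^3 * (u * s)^4 + c * u * (u * s)^2 * t^3) = u ^ 2 * (Z ^ 2 + (a * u * s + b * u^5 * s^4 + c * u * s^2 * t^3)) := by ring

/-- edge ν4 → ν5: centre `V(Z,u,s)`, chart `u`. [kernel] [folklore] -/
theorem face_e4 (Z u s t a b c : R) :
    (u * Z) ^ 2 + (a * u * (u * s) + b * u^5 * (u * s)^4 + c * u * (u * s)^2 * t^3) = u ^ 2 * (Z ^ 2 + (a * s + b * u^7 * s^4 + c * u * s^2 * t^3)) := by ring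

/-- edge ν4 → ν6: centre `V(Z,u,s)`, chart `s`. [kernel] [folklore] -/
theorem face_e5 (Z u s t a b c : R) :
    (s * Z) ^ 2 + (a * (s * u) * s + b * (s * u)^5 * s^4 + c * (s * u) * s^2 * t^3) = s ^ 2 * (Z ^ 2 + (a * u + b * u^5 * s^7 + c * u * s * t^3)) := by ring

/-- edge ν3 → ν7: centre `V(Z,u,s)`, chart `s`. [kernel] [folklore] -/
theorem face_e6 (Z u s t a b c : R) :
    (s * Z) ^ 2 + (a * (s * u)^2 * s + b * (s * u)^3 * s^4 + c * (s * u) * s^2 * t^3) = s ^ 2 * (Z ^ 2 + (a * u^2 * s + b * u^3 * s^5 + c * u * s * t^3)) := by ring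

/-- edge ν7 → ν8: centre `V(Z,u,s)`, chart `u`. [kernel] [folklore] -/
theorem face_e7 (Z u s t a b c : R) :
    (u * Z) ^ 2 + (a * u^2 * (u * s) + b * u^3 * (u * s)^5 + c * u * (u * s) * t^3) = u ^ 2 * (Z ^ 2 + (a * u * s + b * u^6 * s^5 + c * s * t^3)) := by ring

/-- edge ν7 → ν9: centre `V(Z,u,s)`, chart `s`. [kernel] [folklore] -/
theorem face_e8 (Z u s t a b c : R) :
    (s * Z) ^ 2 + (a * (s * u)^2 * s + b * (s * u)^3 * s^5 + c * (s * u) * s * t^3) = s ^ 2 * (Z ^ 2 + (a * u^2 * s + b * u^3 * s^6 + c * u * t^3)) := by ring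

/-- edge ν9 → ν10: centre `V(Z,u,t)`, chart `u`. [kernel] [folklore] -/
theorem face_e9 (Z u s t a b c : R) :
    (u * Z) ^ 2 + (a * u^2 * s + b * u^3 * s^6 + c * u * (u * t)^3) = u ^ 2 * (Z ^ 2 + (a * s + b * u * s^6 + c * u^2 * t^3)) := by ring

/-- edge ν9 → ν11: centre `V(Z,u,t)`, chart `t`. [kernel] [folklore] -/
theorem face_e10 (Z u s t a b c : R) :
    (t * Z) ^ 2 + (a * (t * u)^2 * s + b * (t * u)^3 * s^6 + c * (t * u) * t^3) = t ^ 2 * (Z ^ 2 + (a * u^2 * s + b * u^3 * s^6 * t + c * u * t^2)) := by ring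

/-- edge ν11 → ν12: centre `V(Z,u,t)`, chart `u`. [kernel] [folklore] -/
theorem face_e11 (Z u s t a b c : R) :
    (u * Z) ^ 2 + (a * u^2 * s + b * u^3 * s^6 * (u * t) + c * u * (u * t)^2) = u ^ 2 * (Z ^ 2 + (a * s + b * u^2 * s^6 * t + c * u * t^2)) := by ring

/-- edge ν11 → ν13: centre `V(Z,u,t)`, chart `t`. [kernel] [folklore] -/
theorem face_e12 (Z u s t a b c : R) :
    (t * Z) ^ 2 + (a * (t * u)^2 * s + b * (t * u)^3 * s^6 * t + c * (t * u) * t^2) = t ^ 2 * (Z ^ 2 + (a * u^2 * s + b * u^3 * s^6 * t^2 + c * u * t)) := by ring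

/-- edge ν2 → ν14: centre `V(Z,u,s)`, chart `s`. [kernel] [folklore] -/
theorem face_e13 (Z u s t a b c : R) :
    (s * Z) ^ 2 + (a * (s * u)^3 * s + b * (s * u) * s^4 + c * (s * u) * s^2 * t^3) = s ^ 2 * (Z ^ 2 + (a * u^3 * s^2 + b * u * s^3 + c * u * s * t^3)) := by ring

/-- edge ν14 → ν15: centre `V(Z,u,s)`, chart `u`. [kernel] [folklore] -/
theorem face_e14 (Z u s t a b c : R) :
    (u * Z) ^ 2 + (a * u^3 * (u * s)^2 + b * u * (u * s)^3 + c * u * (u * s) * t^3) = u ^ 2 * (Z ^ 2 + (a * u^3 * s^2 + b * u^2 * s^3 + c * s * t^3)) := by ring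

/-- edge ν15 → ν16: centre `V(Z,s,t)`, chart `s`. [kernel] [folklore] -/
theorem face_e15 (Z u s t a b c : R) :
    (s * Z) ^ 2 + (a * u^3 * s^2 + b * u^2 * s^3 + c * s * (s * t)^3) = s ^ 2 * (Z ^ 2 + (a * u^3 + b * u^2 * s + c * s^2 * t^3)) := by ring

/-- edge ν16 → ν17: centre `V(Z,u,t)`, chart `u`. [kernel] [folklore] -/
theorem face_e16 (Z u s t a b c : R) :
    (u * Z) ^ 2 + (a * u^3 + b * u^2 * s + c * s^2 * (u * t)^3) = u ^ 2 * (Z ^ 2 + (a * u + b * s + c * u * s^2 * t^3)) := by ring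

/-- edge ν16 → ν18: centre `V(Z,u,t)`, chart `t`. [kernel] [folklore] -/
theorem face_e17 (Z u s t a b c : R) :
    (t * Z) ^ 2 + (a * (t * u)^3 + b * (t * u)^2 * s + c * s^2 * t^3) = t ^ 2 * (Z ^ 2 + (a * u^3 * t + b * u^2 * s + c * s^2 * t)) := by ring

/-- edge ν18 → ν19: centre `V(Z,u,s)`, chart `u`. [kernel] [folklore] -/
theorem face_e18 (Z u s t a b c : R) :
    (u * Z) ^ 2 + (a * u^3 * t + b * u^2 * (u * s) + c * (u * s)^2 * t) = u ^ 2 * (Z ^ 2 + (a * u * t + b * u * s + c * s^2 * t)) := by ring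

/-- edge ν18 → ν20: centre `V(Z,u,s)`, chart `s`. [kernel] [folklore] -/
theorem face_e19 (Z u s t a b c : R) :
    (s * Z) ^ 2 + (a * (s * u)^3 * t + b * (s * u)^2 * s + c * s^2 * t) = s ^ 2 * (Z ^ 2 + (a * u^3 * s * t + b * u^2 * s + c * t)) := by ring

/-- edge ν15 → ν21: centre `V(Z,s,t)`, chart `t`. [kernel] [folklore] -/
theorem face_e20 (Z u s t a b c : R) :
    (t * Z) ^ 2 + (a * u^3 * (t * s)^2 + b * u^2 * (t * s)^3 + c * (t * s) * t^3) = t ^ 2 * (Z ^ 2 + (a * u^3 * s^2 + b * u^2 * s^3 * t + c * s * t^2)) := by ring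

/-- edge ν21 → ν22: centre `V(Z,s,t)`, chart `s`. [kernel] [folklore] -/
theorem face_e21 (Z u s t a b c : R) :
    (s * Z) ^ 2 + (a * u^3 * s^2 + b * u^2 * s^3 * (s * t) + c * s * (s * t)^2) = s ^ 2 * (Z ^ 2 + (a * u^3 + b * u^2 * s^2 * t + c * s * t^2)) := by ring

/-- edge ν22 → ν23: centre `V(Z,u,t)`, chart `u`. [kernel] [folklore] -/
theorem face_e22 (Z u s t a b c : R) :
    (u * Z) ^ 2 + (a * u^3 + b * u^2 * s^2 * (u * t) + c * s * (u * t)^2) = u ^ 2 * (Z ^ 2 + (a * u + b * u * s^2 * t + c * s * t^2)) := by ring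

/-- edge ν22 → ν24: centre `V(Z,u,t)`, chart `t`. [kernel] [folklore] -/
theorem face_e23 (Z u s t a b c : R) :
    (t * Z) ^ 2 + (a * (t * u)^3 + b * (t * u)^2 * s^2 * t + c * s * t^2) = t ^ 2 * (Z ^ 2 + (a * u^3 * t + b * u^2 * s^2 * t + c * s)) := by ring

/-- edge ν21 → ν25: centre `V(Z,s,t)`, chart `t`. [kernel] [folklore] -/
theorem face_e24 (Z u s t a b c : R) :
    (t * Z) ^ 2 + (a * u^3 * (t * s)^2 + b * u^2 * (t * s)^3 * t + c * (t * s) * t^2) = t ^ 2 * (Z ^ 2 + (a * u^3 * s^2 + b * u^2 * s^3 * t^2 + c * s * t)) := by ring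

/-- edge ν14 → ν26: centre `V(Z,u,s)`, chart `s`. [kernel] [folklore] -/
theorem face_e25 (Z u s t a b c : R) :
    (s * Z) ^ 2 + (a * (s * u)^3 * s^2 + b * (s * u) * s^3 + c * (s * u) * s * t^3) = s ^ 2 * (Z ^ 2 + (a * u^3 * s^3 + b * u * s^2 + c * u * t^3)) := by ring

/-- edge ν26 → ν27: centre `V(Z,s,t)`, chart `s`. [kernel] [folklore] -/
theorem face_e26 (Z u s t a b c : R) :
    (s * Z) ^ 2 + (a * u^3 * s^3 + b * u * s^2 + c * u * (s * t)^3) = s ^ 2 * (Z ^ 2 + (a * u^3 * s + b * u + c * u * s * t^3)) := by ring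

/-- edge ν26 → ν28: centre `V(Z,s,t)`, chart `t`. [kernel] [folklore] -/
theorem face_e27 (Z u s t a b c : R) :
    (t * Z) ^ 2 + (a * u^3 * (t * s)^3 + b * u * (t * s)^2 + c * u * t^3) = t ^ 2 * (Z ^ 2 + (a * u^3 * s^3 * t + b * u * s^2 + c * u * t)) := by ring

/-- edge ν0 → ν29: centre `V(Z,u,s,t)`, chart `t`. [kernel] [folklore] -/
theorem face_e28 (Z u s t a b c : R) :
    (t * Z) ^ 2 + (a * (t * u)^3 + b * (t * u) * (t * s)^5 + c * (t * u) * t^3) = t ^ 2 * (Z ^ 2 + (a * u^3 * t + b * u * s^5 * t^4 + c * u * t^2)) := by ring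

/-- edge ν29 → ν30: centre `V(Z,u,t)`, chart `u`. [kernel] [folklore] -/
theorem face_e29 (Z u s t a b c : R) :
    (u * Z) ^ 2 + (a * u^3 * (u * t) + b * u * s^5 * (u * t)^4 + c * u * (u * t)^2) = u ^ 2 * (Z ^ 2 + (a * u^2 * t + b * u^3 * s^5 * t^4 + c * u * t^2)) := by ring

/-- edge ν30 → ν31: centre `V(Z,u,t)`, chart `u`. [kernel] [folklore] -/
theorem face_e30 (Z u s t a b c : R) :
    (u * Z) ^ 2 + (a * u^2 * (u * t) + b * u^3 * s^5 * (u * t)^4 + c * u * (u * t)^2) = u ^ 2 * (Z ^ 2 + (a * u * t + b * u^5 * s^5 * t^4 + c * u * t^2)) := by ring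

/-- edge ν31 → ν32: centre `V(Z,u,t)`, chart `u`. [kernel] [folklore] -/
theorem face_e31 (Z u s t a b c : R) :
    (u * Z) ^ 2 + (a * u * (u * t) + b * u^5 * s^5 * (u * t)^4 + c * u * (u * t)^2) = u ^ 2 * (Z ^ 2 + (a * t + b * u^7 * s^5 * t^4 + c * u * t^2)) := by ring

/-- edge ν31 → ν33: centre `V(Z,u,t)`, chart `t`. [kernel] [folklore] -/
theorem face_e32 (Z u s t a b c : R) :
    (t * Z) ^ 2 + (a * (t * u) * t + b * (t * u)^5 * s^5 * t^4 + c * (t * u) * t^2) = t ^ 2 * (Z ^ 2 + (a * u + b * u^5 * s^5 * t^7 + c * u * t)) := by ring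

/-- edge ν30 → ν34: centre `V(Z,u,t)`, chart `t`. [kernel] [folklore] -/
theorem face_e33 (Z u s t a b c : R) :
    (t * Z) ^ 2 + (a * (t * u)^2 * t + b * (t * u)^3 * s^5 * t^4 + c * (t * u) * t^2) = t ^ 2 * (Z ^ 2 + (a * u^2 * t + b * u^3 * s^5 * t^5 + c * u * t)) := by ring

/-- edge ν34 → ν35: centre `V(Z,u,t)`, chart `u`. [kernel] [folklore] -/
theorem face_e34 (Z u s t a b c : R) :
    (u * Z) ^ 2 + (a * u^2 * (u * t) + b * u^3 * s^5 * (u * t)^5 + c * u * (u * t)) = u ^ 2 * (Z ^ 2 + (a * u * t + b * u^6 * s^5 * t^5 + c * t)) := by ring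

/-- edge ν34 → ν36: centre `V(Z,u,t)`, chart `t`. [kernel] [folklore] -/
theorem face_e35 (Z u s t a b c : R) :
    (t * Z) ^ 2 + (a * (t * u)^2 * t + b * (t * u)^3 * s^5 * t^5 + c * (t * u) * t) = t ^ 2 * (Z ^ 2 + (a * u^2 * t + b * u^3 * s^5 * t^6 + c * u)) := by ring

/-- edge ν29 → ν37: centre `V(Z,u,t)`, chart `t`. [kernel] [folklore] -/
theorem face_e36 (Z u s t a b c : R) :
    (t * Z) ^ 2 + (a * (t * u)^3 * t + b * (t * u) * s^5 * t^4 + c * (t * u) * t^2) = t ^ 2 * (Z ^ 2 + (a * u^3 * t^2 + b * u * s^5 * t^3 + c * u * t)) := by ring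

/-- edge ν37 → ν38: centre `V(Z,u,t)`, chart `u`. [kernel] [folklore] -/
theorem face_e37 (Z u s t a b c : R) :
    (u * Z) ^ 2 + (a * u^3 * (u * t)^2 + b * u * s^5 * (u * t)^3 + c * u * (u * t)) = u ^ 2 * (Z ^ 2 + (a * u^3 * t^2 + b * u^2 * s^5 * t^3 + c * t)) := by ring

/-- edge ν37 → ν39: centre `V(Z,u,t)`, chart `t`. [kernel] [folklore] -/
theorem face_e38 (Z u s t a b c : R) :
    (t * Z) ^ 2 + (a * (t * u)^3 * t^2 + b * (t * u) * s^5 * t^3 + c * (t * u) * t) = t ^ 2 * (Z ^ 2 + (a * u^3 * t^3 + b * u * s^5 * t^2 + c * u)) := by ring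

/-! ### §F.0b′  TRANSPORT OF AN ARBITRARY TAIL / ARTIN–SCHREIER MONOMIAL (generic exponents; the ring side of `tmapT`/`tmapB`)

For each chart type of the tree (centre `V(Z, x_A)`, chart `x_j`, `j ∈ A`), the substitution `x_i ↦ x_j x_i (i ∈ A ∖
j)` sends the
monomial `u^a s^b t^c` to `x_j^{Σ_A e} · (the other exponents unchanged)`; dividing by `x_j²` (tails, with `Z ↦ x_jZ` and the
total factor `x_j²` of `f`) resp. by `x_j` (the coefficient `B` of `Z`) is the table's `tmapT` / `tmapB`.  [kernel · `ring`] -/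

/-- `transport_ust_u`: Auxiliary step of this node's calculus, VERBATIM from the lens file (see the module
docstring); the statement is its type. [folklore] -/
theorem transport_ust_u (u s t : R) (a b c : ℕ) : u ^ a * (u * s) ^ b * (u * t) ^ c = u ^ (a + b + c) * (s ^ b * t ^ c) := by ring

/-- `transport_ust_s`: Auxiliary step of this node's calculus, VERBATIM from the lens file (see the module
docstring); the statement is its type. [folklore] -/
theorem transport_ust_s (u s t : R) (a b c : ℕ) : (s * u) ^ a * s ^ b * (s * t) ^ c = s ^ (a + b + c) * (u ^ a * t ^ c) := by ring

/-- `transport_ust_t`: Auxiliary step of this node's calculus, VERBATIM from the lens file (see the module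
docstring); the statement is its type. [folklore] -/
theorem transport_ust_t (u s t : R) (a b c : ℕ) : (t * u) ^ a * (t * s) ^ b * t ^ c = t ^ (a + b + c) * (u ^ a * s ^ b) := by ring

/-- `transport_us_u`: Auxiliary step of this node's calculus, VERBATIM from the lens file (see the module
docstring); the statement is its type. [folklore] -/
theorem transport_us_u (u s t : R) (a b c : ℕ) : u ^ a * (u * s) ^ b * t ^ c = u ^ (a + b) * (s ^ b * t ^ c) := by ring

/-- `transport_us_s`: Auxiliary step of this node's calculus, VERBATIM from the lens file (see the module
docstring); the statement is its type. [folklore] -/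
theorem transport_us_s (u s t : R) (a b c : ℕ) : (s * u) ^ a * s ^ b * t ^ c = s ^ (a + b) * (u ^ a * t ^ c) := by ring

/-- `transport_ut_u`: Auxiliary step of this node's calculus, VERBATIM from the lens file (see the module
docstring); the statement is its type. [folklore] -/
theorem transport_ut_u (u s t : R) (a b c : ℕ) : u ^ a * s ^ b * (u * t) ^ c = u ^ (a + c) * (s ^ b * t ^ c) := by ring

/-- `transport_ut_t`: Auxiliary step of this node's calculus, VERBATIM from the lens file (see the module
docstring); the statement is its type. [folklore] -/
theorem transport_ut_t (u s t : R) (a b c : ℕ) : (t * u) ^ a * s ^ b * t ^ c = t ^ (a + c) * (u ^ a * s ^ b) := by ring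

/-- `transport_st_s`: Auxiliary step of this node's calculus, VERBATIM from the lens file (see the module
docstring); the statement is its type. [folklore] -/
theorem transport_st_s (u s t : R) (a b c : ℕ) : u ^ a * s ^ b * (s * t) ^ c = s ^ (b + c) * (u ^ a * t ^ c) := by ring

/-- `transport_st_t`: Auxiliary step of this node's calculus, VERBATIM from the lens file (see the module
docstring); the statement is its type. [folklore] -/
theorem transport_st_t (u s t : R) (a b c : ℕ) : u ^ a * (t * s) ^ b * t ^ c = t ^ (b + c) * (u ^ a * s ^ b) := by ring

/-- The edge step for the WHOLE strict transform: if `f = Z² + B·Z + F` and the chart substitution gives `σZ = xZ'`,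
`σB = x·B'`, `σF = x²·F'` (the table's exponent bookkeeping: `B ∈ J^B ⊆ I_A`, `F ∈ F0 + J ⊆ I_A²`), then
`σf = x²·(Z'² + B'Z' + F')`.  [kernel · `ring`] [folklore] -/
theorem transport_strict (x Z' B' F' : R) :
    (x * Z') ^ 2 + (x * B') * (x * Z') + x ^ 2 * F' = x ^ 2 * (Z' ^ 2 + B' * Z' + F') := by ring

/-- The `Z`-chart of a blow-up with centre `V(Z, x_A)` carries no point of the strict transform outside the `x_j`-charts:
there `σZ = Z`, `σB = Z·B'`, `σF = Z²·F'` with `B', F' ∈ (x'_A)`, and `σf / Z² = 1 + B' + F' ≡ 1 (mod x'_A)`.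
[kernel · `ring`] [folklore] -/
theorem transport_Zchart (Z B' F' : R) : Z ^ 2 + (Z * B') * Z + Z ^ 2 * F' = Z ^ 2 * (1 + B' + F') := by ring

/-! ### §F.0c  THE LEAF CERTIFICATES — TAIL-ROBUST and ARTIN–SCHREIER-AWARE (NODE-g26 §4, Leaf Lemma)

At a leaf `ν` with `F = F0 + T` (`T ∈ J_ν`), `f = Z² + BZ + F` (`B ∈ J^B_ν`), `2 = 0`, and an EXCEPTIONAL component
`E = {x = 0} ∈ Λ_ν`
with tail orders `(r, r_B)` (= least `x`-exponent in the generators of `J_ν`, `J^B_ν`; table §F.0a): a point `P ∈ E` of order 2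
and `τ = 1` («fat») satisfies `∇F(P) = 0`, `B(P) = 0`, `∇B(P) = 0` and `∂_y∂_z F(P) = c·∂_y∂_z B(P)` with `c² =
F(P)` (Leaf Lemma).
CARRIER (`x ∣ F0`, `r ≥ 2`, `F = x·G`): `F(P) = 0` on `E`, so `c = 0` and the usable entries are `G|_E, ∂_yG|_E,
∂_zG|_E` computed
from `F0` alone; NON-CARRIER (`r ≥ 1`, `F̄0 := F0|_E ≠ 0`): `∂_yF̄0, ∂_zF̄0` always, `∂_y∂_zF̄0` if `r_B ≥ 1` or `F̄0(P) = 0`, and for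
`r ≥ 2` also `∂_xF0|_E` always, `∂_x∂_yF0|_E` if `r_B ≥ 2` or `F̄0(P) = 0`.  Each certificate exhibits a UNIT of the local ring
at every candidate point (a product of the unit coefficients `a b c`, of `F̄0` on the branch `F̄0(P) ≠ 0`, and of the equations
`x'` of OTHER components of `Λ_ν` already certified — a fat point of `E ∩ E'` is excluded by the certificate of `E'`) inside the
ideal of the usable entries: NO FAT POINT on `E`.  Entries are the honest integer derivatives of `F0 = a·m_a + b·m_b + c·m_c`;
the identities hold modulo `2 = 0` (`linear_combination _ * h2`). [kernel] -/

/-- leaf ν1 [d1 u], `F0 = a * u + b * u^4 * s^5 + c * u^2 * t^3`, component `E = {u = 0}` (CARRIER, `r = 2`, `r_B =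
1`): entries used `G|E`; unit = `a`. [kernel] [folklore] -/
theorem face_leaf1_u (a : R) :
    (1) * (a) = a := by
  ring

/-- leaf ν5 [d4 u], `F0 = a * s + b * u^7 * s^4 + c * u * s^2 * t^3`, component `E = {u = 0}` (non-carrier, `r = 2`,
`r_B = 1`): entries used `∂s F̄`; unit = `a`. BRANCH `F̄0(P) = 0` (`c = 0`: all entries usable) [kernel] [folklore] -/
theorem face_leaf5_u_zero (a : R) :
    (1) * (a) = a := by
  ring

/-- leaf ν5 [d4 u], `F0 = a * s + b * u^7 * s^4 + c * u * s^2 * t^3`, component `E = {u = 0}` (non-carrier, `r = 2`,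
`r_B = 1`): entries used `∂s F̄`; unit = `s * a`. BRANCH `F̄0(P) ≠ 0` (`F̄0` inverted; only Artin–Schreier-free
entries) [kernel] [folklore] -/
theorem face_leaf5_u_nonzero (s a : R) :
    (s) * (a) = s * a := by
  ring

/-- leaf ν5 [d4 u], `F0 = a * s + b * u^7 * s^4 + c * u * s^2 * t^3`, component `E = {s = 0}` (CARRIER, `r = 2`,
`r_B = 1`): entries used `G|E`; unit = `a`. [kernel] [folklore] -/
theorem face_leaf5_s (a : R) :
    (1) * (a) = a := by
  ring

/-- leaf ν6 [d4 s], `F0 = a * u + b * u^5 * s^7 + c * u * s * t^3`, component `E = {u = 0}` (CARRIER, `r = 2`, `r_B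
= 1`): entries used `G|E, ∂s G|E`; unit = `a`. [kernel] [folklore] -/
theorem face_leaf6_u (s t a c : R) (h2 : (2 : R) = 0) :
    (1) * (a + s * t^3 * c) + (s) * (t^3 * c) = a := by
  linear_combination (s * t^3 * c) * h2

/-- leaf ν6 [d4 s], `F0 = a * u + b * u^5 * s^7 + c * u * s * t^3`, component `E = {s = 0}` (non-carrier, `r = 2`,
`r_B = 1`): entries used `∂u F̄`; unit = `a`. BRANCH `F̄0(P) = 0` (`c = 0`: all entries usable) [kernel] [folklore] -/
theorem face_leaf6_s_zero (a : R) :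
    (1) * (a) = a := by
  ring

/-- leaf ν6 [d4 s], `F0 = a * u + b * u^5 * s^7 + c * u * s * t^3`, component `E = {s = 0}` (non-carrier, `r = 2`,
`r_B = 1`): entries used `∂u F̄`; unit = `u * a`. BRANCH `F̄0(P) ≠ 0` (`F̄0` inverted; only Artin–Schreier-free
entries) [kernel] [folklore] -/
theorem face_leaf6_s_nonzero (u a : R) :
    (u) * (a) = u * a := by
  ring

/-- leaf ν8 [d4 u], `F0 = a * u * s + b * u^6 * s^5 + c * s * t^3`, component `E = {u = 0}` (non-carrier, `r = 2`,
`r_B = 1`): entries used `∂u∂s F|N`; unit = `a`. BRANCH `F̄0(P) = 0` (`c = 0`: all entries usable) [kernel] [folklore] -/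
theorem face_leaf8_u_zero (a : R) :
    (1) * (a) = a := by
  ring

/-- leaf ν8 [d4 u], `F0 = a * u * s + b * u^6 * s^5 + c * s * t^3`, component `E = {u = 0}` (non-carrier, `r = 2`,
`r_B = 1`): entries used `∂s F̄`; unit = `s * t^3 * c`. BRANCH `F̄0(P) ≠ 0` (`F̄0` inverted; only
Artin–Schreier-free entries) [kernel] [folklore] -/
theorem face_leaf8_u_nonzero (s t c : R) :
    (s) * (t^3 * c) = s * t^3 * c := by
  ring

/-- leaf ν8 [d4 u], `F0 = a * u * s + b * u^6 * s^5 + c * s * t^3`, component `E = {s = 0}` (CARRIER, `r = 2`, `r_B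
= 1`): entries used `∂u G|E`; unit = `a`. [kernel] [folklore] -/
theorem face_leaf8_s (a : R) :
    (1) * (a) = a := by
  ring

end FaceRing

end Summit.ResolutionOfSingularities.ResolutionOfSingularities.Theorems.FaceCut
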